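import Mathlib
import Summits.PneNP.PneNP.Theorems.OverlapGapAlgebraSearchHardWindowSequentialLocalPrep

/-!
# PneNP / OverlapGapAlgebra — `SearchHardWindow` / `SolvableImpliesStableSection`:
# SEQUENTIAL LOCAL RULES are ℓ²-stable (2/4, part c) — the two terms of the cone recursion

Support for cruxes `stmt-PneNP-2460` and `stmt-PneNP-2463` (the sequential local rung). With
`T(Φ, v)` the number of variables reached from `v` by increasing co-occurrence chains in the
instance `Φ` of `F_k(n, m)`, `T_{∖c}` the same avoiding clause `c`, and `S₂(u) = ∑_Φ T(Φ, u)²`: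

* `shwSeq_termA` — `∑_Φ (1 + #hops_Φ(v)) ≤ N (1 + mk²/n)` (slot counts);
* `shwSeq_termB_u` — for `v < u` and a hop pattern `(c, p, q)`:
  `∑_Φ [(Φ c p).1 = v, (Φ c q).1 = u] (1 + #hops_Φ(v)) T_{∖c}(Φ, u)² ≤ (1 + k² + mk²/n)/n² · S₂(u)`
  (pointwise domination, clause factorisation, pair count, exchange bound, monotonicity).
No definitions; axioms `propext`, `Classical.choice`, `Quot.sound`.
-/

set_option linter.dupNamespace false -- `Summit.PneNP.PneNP.…`: summit = sub-problem (D-0017)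

namespace Summit.PneNP.PneNP.Theorems

open Finset
open scoped Classical

section SeqTerms

variable {m k n : ℕ}

/-- **Term A.** `∑_Φ (1 + #hops_Φ(v)) ≤ N (1 + mk²/n)`. -/
theorem shwSeq_termA (hn : 1 ≤ n) (v : Fin n) :
    ∑ Φ : (Fin m → Fin k → Fin n × Bool), (1 + ((((Finset.univ : Finset (Fin m × Fin k × Fin k)).filter fun tt =>
          (Φ tt.1 tt.2.1).1 = v ∧ v < (Φ tt.1 tt.2.2).1)).card : ℝ)) ≤
      (Fintype.card (Fin m → Fin k → Fin n × Bool) : ℝ) * (1 + (m : ℝ) * (k : ℝ) ^ 2 / n) := by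
  have hnpos : (0 : ℝ) < n := by exact_mod_cast hn
  -- `#hops ≤ k · deg(v) = k · ∑_{(c,j)} [slot holds v]`
  have hpt : ∀ Φ : (Fin m → Fin k → Fin n × Bool), ((((Finset.univ : Finset (Fin m × Fin k × Fin k)).filter fun tt =>
          (Φ tt.1 tt.2.1).1 = v ∧ v < (Φ tt.1 tt.2.2).1)).card : ℝ) ≤
      k * ∑ cp : Fin m × Fin k, (if (Φ cp.1 cp.2).1 = v then (1 : ℝ) else 0) := by
    intro Φ
    have h := shwSeq_card_hops_le Φ v
    rw [Finset.sum_boole]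
    exact_mod_cast h
  have hslot : ∀ cp : Fin m × Fin k,
      ∑ Φ : (Fin m → Fin k → Fin n × Bool), (if (Φ cp.1 cp.2).1 = v then (1 : ℝ) else 0) = (Fintype.card (Fin m → Fin k → Fin n × Bool) : ℝ) / n := by
    intro cp
    have h := shwSeq_sum_slot_indicator cp.1 cp.2 v (fun _ => (1 : ℝ)) (fun _ _ => rfl)
    simp only [Finset.sum_const, Finset.card_univ, nsmul_eq_mul, mul_one] at h
    rw [Finset.sum_boole, eq_div_iff hnpos.ne', mul_comm]
    exact h
  calc ∑ Φ : (Fin m → Fin k → Fin n × Bool), (1 + ((((Finset.univ : Finset (Fin m × Fin k × Fin k)).filter fun tt =>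
          (Φ tt.1 tt.2.1).1 = v ∧ v < (Φ tt.1 tt.2.2).1)).card : ℝ))
      ≤ ∑ Φ : (Fin m → Fin k → Fin n × Bool), (1 + k * ∑ cp : Fin m × Fin k, (if (Φ cp.1 cp.2).1 = v then (1 : ℝ) else 0)) :=
        Finset.sum_le_sum fun Φ _ => by linarith [hpt Φ]
    _ = (Fintype.card (Fin m → Fin k → Fin n × Bool) : ℝ) + k * ∑ cp : Fin m × Fin k,
          ∑ Φ : (Fin m → Fin k → Fin n × Bool), (if (Φ cp.1 cp.2).1 = v then (1 : ℝ) else 0) := by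
        rw [Finset.sum_add_distrib, Finset.sum_const, Finset.card_univ, nsmul_eq_mul, mul_one,
          ← Finset.mul_sum, Finset.sum_comm]
    _ = (Fintype.card (Fin m → Fin k → Fin n × Bool) : ℝ) + k * ((Fintype.card (Fin m × Fin k) : ℝ) *
          ((Fintype.card (Fin m → Fin k → Fin n × Bool) : ℝ) / n)) := by
        rw [Finset.sum_congr rfl fun cp _ => hslot cp, Finset.sum_const, Finset.card_univ,
          nsmul_eq_mul]
    _ = (Fintype.card (Fin m → Fin k → Fin n × Bool) : ℝ) * (1 + (m : ℝ) * (k : ℝ) ^ 2 / n) := by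
        rw [Fintype.card_prod, Fintype.card_fin, Fintype.card_fin]; push_cast; ring

/-- **Term B, one hop, one target.** For `v < u` and a hop pattern `(c, p, q)`:
`∑_Φ [(Φ c p).1 = v ∧ (Φ c q).1 = u] (1 + #hops_Φ(v)) T_{∖c}(Φ, u)² ≤ (1 + k² + mk²/n)/n² · S₂(u)`. -/
theorem shwSeq_termB_u (hn : 1 ≤ n) (v u : Fin n) (hvu : v < u) (c : Fin m) (p q : Fin k) :
    ∑ Φ : (Fin m → Fin k → Fin n × Bool), (if (Φ c p).1 = v ∧ (Φ c q).1 = u then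
        (1 + ((((Finset.univ : Finset (Fin m × Fin k × Fin k)).filter fun tt =>
          (Φ tt.1 tt.2.1).1 = v ∧ v < (Φ tt.1 tt.2.2).1)).card : ℝ)) *
          ((((Finset.univ : Finset (Fin n)).filter fun ww => (∃ (ll : ℕ) (xx : ℕ → Fin n), xx 0 = u ∧ xx ll = ww ∧ ∀ ss : ℕ, ss < ll →
          (xx ss < xx (ss + 1) ∧ ∃ cc ∈ ((Finset.univ : Finset (Fin m)).erase c), ∃ pp qq : Fin k,
            (Φ cc pp).1 = xx ss ∧ (Φ cc qq).1 = xx (ss + 1)))).card : ℕ) : ℝ) ^ 2 else 0) ≤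
      (1 + (k : ℝ) ^ 2 + (m : ℝ) * (k : ℝ) ^ 2 / n) / (n : ℝ) ^ 2 * (∑ Φ : (Fin m → Fin k → Fin n × Bool), ((((Finset.univ : Finset (Fin n)).filter fun ww => (∃ (ll : ℕ) (xx : ℕ → Fin n), xx 0 = u ∧ xx ll = ww ∧ ∀ ss : ℕ, ss < ll →
          (xx ss < xx (ss + 1) ∧ ∃ cc ∈ (Finset.univ : Finset (Fin m)), ∃ pp qq : Fin k,
            (Φ cc pp).1 = xx ss ∧ (Φ cc qq).1 = xx (ss + 1)))).card : ℕ) : ℝ) ^ 2) := by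
  have hnpos : (0 : ℝ) < n := by exact_mod_cast hn
  set Tc : (Fin m → Fin k → Fin n × Bool) → ℝ := fun Φ =>
    ((((Finset.univ : Finset (Fin n)).filter fun ww => (∃ (ll : ℕ) (xx : ℕ → Fin n), xx 0 = u ∧ xx ll = ww ∧ ∀ ss : ℕ, ss < ll →
          (xx ss < xx (ss + 1) ∧ ∃ cc ∈ ((Finset.univ : Finset (Fin m)).erase c), ∃ pp qq : Fin k,
            (Φ cc pp).1 = xx ss ∧ (Φ cc qq).1 = xx (ss + 1)))).card : ℕ) : ℝ) with hTc
  set Tu : (Fin m → Fin k → Fin n × Bool) → ℝ := fun Φ =>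
    ((((Finset.univ : Finset (Fin n)).filter fun ww => (∃ (ll : ℕ) (xx : ℕ → Fin n), xx 0 = u ∧ xx ll = ww ∧ ∀ ss : ℕ, ss < ll →
          (xx ss < xx (ss + 1) ∧ ∃ cc ∈ (Finset.univ : Finset (Fin m)), ∃ pp qq : Fin k,
            (Φ cc pp).1 = xx ss ∧ (Φ cc qq).1 = xx (ss + 1)))).card : ℕ) : ℝ) with hTu
  set dg : (Fin m → Fin k → Fin n × Bool) → ℝ := fun Φ => ((((Finset.univ : Finset (Fin m × Fin k)).filter fun cp =>
        cp.1 ≠ c ∧ (Φ cp.1 cp.2).1 = v).card : ℕ) : ℝ) with hdg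
  set G : (Fin m → Fin k → Fin n × Bool) → ℝ := fun Φ => (1 + (k : ℝ) * k + k * dg Φ) * Tc Φ ^ 2 with hG
  set w : (Fin k → Fin n × Bool) → ℝ := fun y => if (y p).1 = v ∧ (y q).1 = u then 1 else 0 with hw
  -- Step 1: pointwise domination by `w(Φ c) · G(Φ)`
  have hstep1 : ∀ Φ : (Fin m → Fin k → Fin n × Bool), (if (Φ c p).1 = v ∧ (Φ c q).1 = u then
        (1 + ((((Finset.univ : Finset (Fin m × Fin k × Fin k)).filter fun tt =>
          (Φ tt.1 tt.2.1).1 = v ∧ v < (Φ tt.1 tt.2.2).1)).card : ℝ)) * Tc Φ ^ 2 else 0) ≤ w (Φ c) * G Φ := by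
    intro Φ
    by_cases hcond : (Φ c p).1 = v ∧ (Φ c q).1 = u
    · rw [if_pos hcond, hw]
      simp only [hcond, and_self, if_true, one_mul, hG]
      have hh : ((((Finset.univ : Finset (Fin m × Fin k × Fin k)).filter fun tt =>
          (Φ tt.1 tt.2.1).1 = v ∧ v < (Φ tt.1 tt.2.2).1)).card : ℝ) ≤ (k : ℝ) * k + k * dg Φ := by
        have := shwSeq_card_hops_le_off Φ v c
        simp only [hdg]; exact_mod_cast this
      have hT0 : 0 ≤ Tc Φ ^ 2 := sq_nonneg _
      nlinarith
    · rw [if_neg hcond, hw]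
      simp only [hcond, if_false, zero_mul, le_refl]
  -- Step 2: clause factorisation (`G` is blind to clause `c`)
  have hGblind : ∀ (Φ : (Fin m → Fin k → Fin n × Bool)) (y : Fin k → Fin n × Bool), G (Function.update Φ c y) = G Φ := by
    intro Φ y
    simp only [hG, hTc, hdg]
    rw [shwSeq_T_erase_update Φ c y u, shwSeq_degoff_update Φ c y v]
  have hfac := shwSeq_sum_clause_factor c w G hGblind
  -- Step 3: `∑_y w y ≤ card / n²`
  have hwsum : (∑ y : Fin k → Fin n × Bool, w y) * (n : ℝ) ^ 2 ≤
      Fintype.card (Fin k → Fin n × Bool) := by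
    have h := shwSeq_card_pair_mul_le p q v u (ne_of_lt hvu)
    rw [hw, Finset.sum_boole]
    exact h
  have hGnn : 0 ≤ ∑ Φ : (Fin m → Fin k → Fin n × Bool), G Φ := by
    refine Finset.sum_nonneg fun Φ _ => ?_
    rw [hG]
    have : 0 ≤ dg Φ := Nat.cast_nonneg _
    positivity
  have hcardpos : (0 : ℝ) < Fintype.card (Fin k → Fin n × Bool) := by
    have : Nonempty (Fin k → Fin n × Bool) := ⟨fun _ => (⟨0, hn⟩, true)⟩
    exact_mod_cast Fintype.card_pos
  have hstep3 : ∑ Φ : (Fin m → Fin k → Fin n × Bool), w (Φ c) * G Φ ≤ (∑ Φ : (Fin m → Fin k → Fin n × Bool), G Φ) / (n : ℝ) ^ 2 := by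
    rw [le_div_iff₀ (by positivity)]
    have h1 : (Fintype.card (Fin k → Fin n × Bool) : ℝ) * ((∑ Φ : (Fin m → Fin k → Fin n × Bool), w (Φ c) * G Φ) * (n : ℝ) ^ 2)
        ≤ (Fintype.card (Fin k → Fin n × Bool) : ℝ) * ∑ Φ : (Fin m → Fin k → Fin n × Bool), G Φ := by
      calc (Fintype.card (Fin k → Fin n × Bool) : ℝ) * ((∑ Φ : (Fin m → Fin k → Fin n × Bool), w (Φ c) * G Φ) * (n : ℝ) ^ 2)
          = ((∑ y : Fin k → Fin n × Bool, w y) * (n : ℝ) ^ 2) * ∑ Φ : (Fin m → Fin k → Fin n × Bool), G Φ := by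
            rw [← mul_assoc, hfac]; ring
        _ ≤ (Fintype.card (Fin k → Fin n × Bool) : ℝ) * ∑ Φ : (Fin m → Fin k → Fin n × Bool), G Φ :=
            mul_le_mul_of_nonneg_right hwsum hGnn
    exact le_of_mul_le_mul_left h1 hcardpos
  -- Step 4: `∑_Φ G ≤ (1 + k² + mk²/n) S₂(u)`
  have hTcTu : ∀ Φ : (Fin m → Fin k → Fin n × Bool), Tc Φ ≤ Tu Φ := by
    intro Φ
    simp only [hTc, hTu]
    have hsub := Finset.card_le_card (s := (Finset.univ : Finset (Fin n)).filter fun ww =>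
        (∃ (ll : ℕ) (xx : ℕ → Fin n), xx 0 = u ∧ xx ll = ww ∧ ∀ ss : ℕ, ss < ll →
          (xx ss < xx (ss + 1) ∧ ∃ cc ∈ ((Finset.univ : Finset (Fin m)).erase c), ∃ pp qq : Fin k,
            (Φ cc pp).1 = xx ss ∧ (Φ cc qq).1 = xx (ss + 1))))
      (t := (Finset.univ : Finset (Fin n)).filter fun ww =>
        (∃ (ll : ℕ) (xx : ℕ → Fin n), xx 0 = u ∧ xx ll = ww ∧ ∀ ss : ℕ, ss < ll →
          (xx ss < xx (ss + 1) ∧ ∃ cc ∈ (Finset.univ : Finset (Fin m)), ∃ pp qq : Fin k,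
            (Φ cc pp).1 = xx ss ∧ (Φ cc qq).1 = xx (ss + 1)))) (by
        intro w hw
        rw [Finset.mem_filter] at hw ⊢
        exact ⟨hw.1, shwSeq_reach_mono Φ _ _ (Finset.erase_subset _ _) u w hw.2⟩)
    exact_mod_cast hsub
  have hTc2 : ∑ Φ : (Fin m → Fin k → Fin n × Bool), Tc Φ ^ 2 ≤ (∑ Φ : (Fin m → Fin k → Fin n × Bool), ((((Finset.univ : Finset (Fin n)).filter fun ww => (∃ (ll : ℕ) (xx : ℕ → Fin n), xx 0 = u ∧ xx ll = ww ∧ ∀ ss : ℕ, ss < ll →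
          (xx ss < xx (ss + 1) ∧ ∃ cc ∈ (Finset.univ : Finset (Fin m)), ∃ pp qq : Fin k,
            (Φ cc pp).1 = xx ss ∧ (Φ cc qq).1 = xx (ss + 1)))).card : ℕ) : ℝ) ^ 2) :=
    Finset.sum_le_sum fun Φ _ => pow_le_pow_left₀ (Nat.cast_nonneg _) (hTcTu Φ) 2
  have hdgsum : ∑ Φ : (Fin m → Fin k → Fin n × Bool), dg Φ * Tc Φ ^ 2 ≤ (m : ℝ) * k / n * (∑ Φ : (Fin m → Fin k → Fin n × Bool), ((((Finset.univ : Finset (Fin n)).filter fun ww => (∃ (ll : ℕ) (xx : ℕ → Fin n), xx 0 = u ∧ xx ll = ww ∧ ∀ ss : ℕ, ss < ll →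
          (xx ss < xx (ss + 1) ∧ ∃ cc ∈ (Finset.univ : Finset (Fin m)), ∃ pp qq : Fin k,
            (Φ cc pp).1 = xx ss ∧ (Φ cc qq).1 = xx (ss + 1)))).card : ℕ) : ℝ) ^ 2) := by
    -- `dg Φ ≤ ∑_{(c',j)} [slot holds v]`
    have hdgle : ∀ Φ : (Fin m → Fin k → Fin n × Bool), dg Φ ≤
        ∑ cp : Fin m × Fin k, (if (Φ cp.1 cp.2).1 = v then (1 : ℝ) else 0) := by
      intro Φ
      simp only [hdg]
      rw [Finset.sum_boole]
      exact_mod_cast Finset.card_le_card (fun cp hcp => by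
        rw [Finset.mem_filter] at hcp ⊢; exact ⟨hcp.1, hcp.2.2⟩)
    have hex : ∀ cp : Fin m × Fin k,
        ∑ Φ : (Fin m → Fin k → Fin n × Bool), (if (Φ cp.1 cp.2).1 = v then (1 : ℝ) else 0) * Tc Φ ^ 2 ≤
          (1 / n) * ∑ Φ : (Fin m → Fin k → Fin n × Bool), Tc Φ ^ 2 := by
      intro cp
      have h := shwSeq_slot_exchange_T v u hvu c cp.1 cp.2
      have hg : ∑ Φ : (Fin m → Fin k → Fin n × Bool), (if (Φ cp.1 cp.2).1 = v then (1 : ℝ) else 0) * Tc Φ ^ 2 =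
          ∑ Φ ∈ (Finset.univ : Finset (Fin m → Fin k → Fin n × Bool)).filter (fun Φ => (Φ cp.1 cp.2).1 = v), Tc Φ ^ 2 := by
        rw [Finset.sum_filter]
        refine Finset.sum_congr rfl fun Φ _ => ?_
        split_ifs <;> simp
      rw [hg, div_mul_eq_mul_div, one_mul, le_div_iff₀ hnpos, mul_comm]
      exact h
    calc ∑ Φ : (Fin m → Fin k → Fin n × Bool), dg Φ * Tc Φ ^ 2
        ≤ ∑ Φ : (Fin m → Fin k → Fin n × Bool), (∑ cp : Fin m × Fin k, (if (Φ cp.1 cp.2).1 = v then (1 : ℝ) else 0)) *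
            Tc Φ ^ 2 :=
          Finset.sum_le_sum fun Φ _ => mul_le_mul_of_nonneg_right (hdgle Φ) (sq_nonneg _)
      _ = ∑ cp : Fin m × Fin k, ∑ Φ : (Fin m → Fin k → Fin n × Bool),
            (if (Φ cp.1 cp.2).1 = v then (1 : ℝ) else 0) * Tc Φ ^ 2 := by
          rw [Finset.sum_comm]
          exact Finset.sum_congr rfl fun Φ _ => Finset.sum_mul _ _ _
      _ ≤ ∑ _cp : Fin m × Fin k, (1 / n) * ∑ Φ : (Fin m → Fin k → Fin n × Bool), Tc Φ ^ 2 :=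
          Finset.sum_le_sum fun cp _ => hex cp
      _ = (m : ℝ) * k / n * ∑ Φ : (Fin m → Fin k → Fin n × Bool), Tc Φ ^ 2 := by
          rw [Finset.sum_const, Finset.card_univ, nsmul_eq_mul, Fintype.card_prod,
            Fintype.card_fin, Fintype.card_fin]
          push_cast; ring
      _ ≤ (m : ℝ) * k / n * (∑ Φ : (Fin m → Fin k → Fin n × Bool), ((((Finset.univ : Finset (Fin n)).filter fun ww => (∃ (ll : ℕ) (xx : ℕ → Fin n), xx 0 = u ∧ xx ll = ww ∧ ∀ ss : ℕ, ss < ll →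
          (xx ss < xx (ss + 1) ∧ ∃ cc ∈ (Finset.univ : Finset (Fin m)), ∃ pp qq : Fin k,
            (Φ cc pp).1 = xx ss ∧ (Φ cc qq).1 = xx (ss + 1)))).card : ℕ) : ℝ) ^ 2) :=
          mul_le_mul_of_nonneg_left hTc2 (by positivity)
  have hstep4 : ∑ Φ : (Fin m → Fin k → Fin n × Bool), G Φ ≤ (1 + (k : ℝ) ^ 2 + (m : ℝ) * (k : ℝ) ^ 2 / n) * (∑ Φ : (Fin m → Fin k → Fin n × Bool), ((((Finset.univ : Finset (Fin n)).filter fun ww => (∃ (ll : ℕ) (xx : ℕ → Fin n), xx 0 = u ∧ xx ll = ww ∧ ∀ ss : ℕ, ss < ll →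
          (xx ss < xx (ss + 1) ∧ ∃ cc ∈ (Finset.univ : Finset (Fin m)), ∃ pp qq : Fin k,
            (Φ cc pp).1 = xx ss ∧ (Φ cc qq).1 = xx (ss + 1)))).card : ℕ) : ℝ) ^ 2) := by
    have hsplit : ∑ Φ : (Fin m → Fin k → Fin n × Bool), G Φ =
        (1 + (k : ℝ) * k) * ∑ Φ : (Fin m → Fin k → Fin n × Bool), Tc Φ ^ 2 + k * ∑ Φ : (Fin m → Fin k → Fin n × Bool), dg Φ * Tc Φ ^ 2 := by
      rw [Finset.mul_sum, Finset.mul_sum, ← Finset.sum_add_distrib]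
      refine Finset.sum_congr rfl fun Φ _ => ?_
      rw [hG]; ring
    rw [hsplit]
    have hk0 : (0 : ℝ) ≤ k := Nat.cast_nonneg _
    have h1 : (1 + (k : ℝ) * k) * ∑ Φ : (Fin m → Fin k → Fin n × Bool), Tc Φ ^ 2 ≤ (1 + (k : ℝ) * k) * (∑ Φ : (Fin m → Fin k → Fin n × Bool), ((((Finset.univ : Finset (Fin n)).filter fun ww => (∃ (ll : ℕ) (xx : ℕ → Fin n), xx 0 = u ∧ xx ll = ww ∧ ∀ ss : ℕ, ss < ll →
          (xx ss < xx (ss + 1) ∧ ∃ cc ∈ (Finset.univ : Finset (Fin m)), ∃ pp qq : Fin k,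
            (Φ cc pp).1 = xx ss ∧ (Φ cc qq).1 = xx (ss + 1)))).card : ℕ) : ℝ) ^ 2) :=
      mul_le_mul_of_nonneg_left hTc2 (by positivity)
    have h2 : (k : ℝ) * ∑ Φ : (Fin m → Fin k → Fin n × Bool), dg Φ * Tc Φ ^ 2 ≤ k * ((m : ℝ) * k / n * (∑ Φ : (Fin m → Fin k → Fin n × Bool), ((((Finset.univ : Finset (Fin n)).filter fun ww => (∃ (ll : ℕ) (xx : ℕ → Fin n), xx 0 = u ∧ xx ll = ww ∧ ∀ ss : ℕ, ss < ll →
          (xx ss < xx (ss + 1) ∧ ∃ cc ∈ (Finset.univ : Finset (Fin m)), ∃ pp qq : Fin k,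
            (Φ cc pp).1 = xx ss ∧ (Φ cc qq).1 = xx (ss + 1)))).card : ℕ) : ℝ) ^ 2)) :=
      mul_le_mul_of_nonneg_left hdgsum hk0
    have h3 : (1 + (k : ℝ) * k) * (∑ Φ : (Fin m → Fin k → Fin n × Bool), ((((Finset.univ : Finset (Fin n)).filter fun ww => (∃ (ll : ℕ) (xx : ℕ → Fin n), xx 0 = u ∧ xx ll = ww ∧ ∀ ss : ℕ, ss < ll →
          (xx ss < xx (ss + 1) ∧ ∃ cc ∈ (Finset.univ : Finset (Fin m)), ∃ pp qq : Fin k,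
            (Φ cc pp).1 = xx ss ∧ (Φ cc qq).1 = xx (ss + 1)))).card : ℕ) : ℝ) ^ 2) + k * ((m : ℝ) * k / n * (∑ Φ : (Fin m → Fin k → Fin n × Bool), ((((Finset.univ : Finset (Fin n)).filter fun ww => (∃ (ll : ℕ) (xx : ℕ → Fin n), xx 0 = u ∧ xx ll = ww ∧ ∀ ss : ℕ, ss < ll →
          (xx ss < xx (ss + 1) ∧ ∃ cc ∈ (Finset.univ : Finset (Fin m)), ∃ pp qq : Fin k,
            (Φ cc pp).1 = xx ss ∧ (Φ cc qq).1 = xx (ss + 1)))).card : ℕ) : ℝ) ^ 2)) =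
        (1 + (k : ℝ) ^ 2 + (m : ℝ) * (k : ℝ) ^ 2 / n) * (∑ Φ : (Fin m → Fin k → Fin n × Bool), ((((Finset.univ : Finset (Fin n)).filter fun ww => (∃ (ll : ℕ) (xx : ℕ → Fin n), xx 0 = u ∧ xx ll = ww ∧ ∀ ss : ℕ, ss < ll →
          (xx ss < xx (ss + 1) ∧ ∃ cc ∈ (Finset.univ : Finset (Fin m)), ∃ pp qq : Fin k,
            (Φ cc pp).1 = xx ss ∧ (Φ cc qq).1 = xx (ss + 1)))).card : ℕ) : ℝ) ^ 2) := by ring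
    linarith
  -- Step 5
  have hS0 : 0 ≤ (∑ Φ : (Fin m → Fin k → Fin n × Bool), ((((Finset.univ : Finset (Fin n)).filter fun ww => (∃ (ll : ℕ) (xx : ℕ → Fin n), xx 0 = u ∧ xx ll = ww ∧ ∀ ss : ℕ, ss < ll →
          (xx ss < xx (ss + 1) ∧ ∃ cc ∈ (Finset.univ : Finset (Fin m)), ∃ pp qq : Fin k,
            (Φ cc pp).1 = xx ss ∧ (Φ cc qq).1 = xx (ss + 1)))).card : ℕ) : ℝ) ^ 2) := Finset.sum_nonneg fun Φ _ => sq_nonneg _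
  calc ∑ Φ : (Fin m → Fin k → Fin n × Bool), (if (Φ c p).1 = v ∧ (Φ c q).1 = u then
        (1 + ((((Finset.univ : Finset (Fin m × Fin k × Fin k)).filter fun tt =>
          (Φ tt.1 tt.2.1).1 = v ∧ v < (Φ tt.1 tt.2.2).1)).card : ℝ)) * Tc Φ ^ 2 else 0)
      ≤ ∑ Φ : (Fin m → Fin k → Fin n × Bool), w (Φ c) * G Φ := Finset.sum_le_sum fun Φ _ => hstep1 Φ
    _ ≤ (∑ Φ : (Fin m → Fin k → Fin n × Bool), G Φ) / (n : ℝ) ^ 2 := hstep3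
    _ ≤ (1 + (k : ℝ) ^ 2 + (m : ℝ) * (k : ℝ) ^ 2 / n) * (∑ Φ : (Fin m → Fin k → Fin n × Bool), ((((Finset.univ : Finset (Fin n)).filter fun ww => (∃ (ll : ℕ) (xx : ℕ → Fin n), xx 0 = u ∧ xx ll = ww ∧ ∀ ss : ℕ, ss < ll →
          (xx ss < xx (ss + 1) ∧ ∃ cc ∈ (Finset.univ : Finset (Fin m)), ∃ pp qq : Fin k,
            (Φ cc pp).1 = xx ss ∧ (Φ cc qq).1 = xx (ss + 1)))).card : ℕ) : ℝ) ^ 2) / (n : ℝ) ^ 2 :=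
        div_le_div_of_nonneg_right hstep4 (by positivity)
    _ = (1 + (k : ℝ) ^ 2 + (m : ℝ) * (k : ℝ) ^ 2 / n) / (n : ℝ) ^ 2 * (∑ Φ : (Fin m → Fin k → Fin n × Bool), ((((Finset.univ : Finset (Fin n)).filter fun ww => (∃ (ll : ℕ) (xx : ℕ → Fin n), xx 0 = u ∧ xx ll = ww ∧ ∀ ss : ℕ, ss < ll →
          (xx ss < xx (ss + 1) ∧ ∃ cc ∈ (Finset.univ : Finset (Fin m)), ∃ pp qq : Fin k,
            (Φ cc pp).1 = xx ss ∧ (Φ cc qq).1 = xx (ss + 1)))).card : ℕ) : ℝ) ^ 2) := by ring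

end SeqTerms

end Summit.PneNP.PneNP.Theorems
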